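import Summits.AnomalousDissipation.AnomalousDissipation.Theorems.SolenoidalFractalHomogenisationLagrangianStepCellChainModes
import HarnessLib

/-!
# K1L_D `LagrangianRenormalisationStepDesign` (stmt-AnomalousDissipation-27980), W7 engine sub-piece S1a: the CONJUGATE-PAIR DISSIPATION SPLIT
# (hypothesis (H2) of the assembly owner's `W7Slot.slot_step`) for every weak solution of the flat tensor cell problem
# (helper; `--supports stmt-AnomalousDissipation-27980`)

Summits-side helper file of route `SolenoidalFractalHomogenisation` (prover seat `ad-k1l-cellLawV-w1` g4; shape request (i) of the W7 assembly owner
ad-sawtooth-k1loc-p1 g11, STATUS 2026-08-28T22:16:05Z).  Everything proved; no definitions, no named facts, no sorry.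

With `E, Q` the energy representative and dissipation density of `…CellChainEnergy.exists_energyRep` (only two of its conjuncts are used, passed as
hypotheses: `E t = ∫‖u t‖²` a.e. and `4π² Σ_{k∈S} Re⟪û_k, T_𝔹(k) û_k⟫ ≤ Q t` for every finite `S`, a.e.), a slow chain `Kⱼ = K₀ + j·K_s`,
`j ∈ {−2,…,2}`, whose ten vectors `±Kⱼ` are distinct (`K_s ≠ 0` and the `+`/`−` windows disjoint — the case `k̃ < 1/2`), the gauge `μ = σ·e^{−iφ}`,
`σ = ±1`, and a rate `dmin ≥ 0` below twice the coercive rate `8π²·lo·|k|²` of every OTHER mode the solution carries: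

* §1 symmetries of the symbol form: evenness in `k` and under conjugation (`re_inner_symbT_neg_conj`), invariance under unit scalars
  (`re_inner_symbT_smul`, `norm_zpow_gauge_smul`), and `Re⟪modalAdjGen 𝔹ᵀ K w, w⟫ = 4π² Re⟪w, T_𝔹(K) w⟫` for transversal `w`
  (`re_inner_modalAdjGen_majorTranspose`);
* §2 `block_split_le` — the fixed-time inequality: `4π² Σ_{k∈W} Re_k + (dmin/2)(E − Σ_{k∈W} ‖X k‖²) ≤ q` for ANY finite block `W`, from Parseval,
  the block bounds and the gap off `W` (least-upper-bound argument on the complement);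
* §3 **`ae_pair_dissipation_split`** — for a.e. `t ∈ (0,T)`:
  `2·Σ_{|j|≤2} Re⟪modalAdjGen (majorTranspose 𝔹) Kⱼ w̃ⱼ(t), w̃ⱼ(t)⟫ + (dmin/2)·(E t − 2·Σ_{|j|≤2} ‖w̃ⱼ(t)‖²) ≤ Q t`,
  `w̃ⱼ(t) = μ^j • û(t)(Kⱼ)` (reality `û(−k) = conj û(k)` folds the mirror chain in: multiplicity `2`); cell form with the continuous representatives
  `modeRep` (`ae_pair_dissipation_split_rep`).
NOT a proof of any registered stub, of the crux, or of anomalous dissipation; rung F-D1.A0 infrastructure.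
-/

set_option linter.dupNamespace false

noncomputable section

namespace Summit.AnomalousDissipation.AnomalousDissipation.Theorems.SolenoidalFractalHomogenisation.LagrangianStep.CellChain

open Set MeasureTheory Filter Topology Function Complex UnitAddTorus
open scoped InnerProductSpace ComplexConjugate ENNReal
open Literature.Analysis Literature.Analysis.FunctionSpaces Literature.Analysis.FunctionSpaces.Torus
open Literature.Analysis.FluidPDE Literature.Analysis.FluidPDE.Torus Literature.Analysis.FluidPDE.LatticeShear
open Summit.AnomalousDissipation.AnomalousDissipation.Theorems.SolenoidalFractalHomogenisation.RealisedQuasiStaticCellLaw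

/-! ## §1 Symmetries of the symbol form -/

/-- The symbol is even in the wave vector. [cite: Frisch1995Turbulence, §9.6.3 eq. (9.57) p. 233] -/
theorem symb_neg_left (𝔸 : Torus.Visc4 (Fin 3)) (k p : Fin 3 → ℝ) : Torus.symb 𝔸 (-k) p = Torus.symb 𝔸 k p := by
  unfold Torus.symb
  refine Finset.sum_congr rfl fun i _ => Finset.sum_congr rfl fun a _ => Finset.sum_congr rfl fun j _ =>
    Finset.sum_congr rfl fun b _ => ?_
  simp only [Pi.neg_apply]
  ring

/-- The symbol is even in the polarisation. [cite: Frisch1995Turbulence, §9.6.3 eq. (9.57) p. 233] -/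
theorem symb_neg_right (𝔸 : Torus.Visc4 (Fin 3)) (k p : Fin 3 → ℝ) : Torus.symb 𝔸 k (-p) = Torus.symb 𝔸 k p := by
  unfold Torus.symb
  refine Finset.sum_congr rfl fun i _ => Finset.sum_congr rfl fun a _ => Finset.sum_congr rfl fun j _ =>
    Finset.sum_congr rfl fun b _ => ?_
  simp only [Pi.neg_apply]
  ring

/-- **Mirror modes dissipate alike**: if `X′ᵢ = conj Xᵢ` then `Re⟪X′, T_𝔸(−k) X′⟫ = Re⟪X, T_𝔸(k) X⟫`. [cite: Frisch1995Turbulence, §9.6.3 eq. (9.57) p. 233] -/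
theorem re_inner_symbT_neg_conj (𝔸 : Torus.Visc4 (Fin 3)) (k : Fin 3 → ℤ) {X X' : EuclideanSpace ℂ (Fin 3)}
    (hX' : ∀ i, X' i = starRingEnd ℂ (X i)) :
    (⟪X', Torus.symbT 𝔸 (-k) X'⟫_ℂ).re = (⟪X, Torus.symbT 𝔸 k X⟫_ℂ).re := by
  rw [Torus.re_inner_symbT_eq, Torus.re_inner_symbT_eq]
  have hre : (fun i => (X' i).re) = fun i => (X i).re := funext fun i => by rw [hX' i, Complex.conj_re]
  have him : (fun i => (X' i).im) = -fun i => (X i).im := funext fun i => by rw [hX' i, Complex.conj_im, Pi.neg_apply]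
  have hk : (fun a => ((-k) a : ℝ)) = -fun a => (k a : ℝ) := funext fun a => by simp
  rw [hre, him, hk, symb_neg_left, symb_neg_left, symb_neg_right]

/-- Unit scalars do not change the symbol form: `Re⟪c•x, T(c•x)⟫ = ‖c‖²·Re⟪x, T x⟫`. [cite: Frisch1995Turbulence, §9.6.3 eq. (9.57) p. 233] -/
theorem re_inner_symbT_smul (𝔸 : Torus.Visc4 (Fin 3)) (k : Fin 3 → ℤ) (c : ℂ) (x : EuclideanSpace ℂ (Fin 3)) :
    (⟪c • x, Torus.symbT 𝔸 k (c • x)⟫_ℂ).re = ‖c‖ ^ 2 * (⟪x, Torus.symbT 𝔸 k x⟫_ℂ).re := by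
  rw [Torus.symbT_smul, inner_smul_left, inner_smul_right, ← mul_assoc, Complex.conj_mul' c, ← Complex.ofReal_pow,
    Complex.re_ofReal_mul]

/-- The gauge is unimodular: `‖σ · conj e^{iφ}‖ = 1` for `σ = ±1`. [folklore] -/
theorem norm_gauge {σ : ℝ} (hσ : σ = 1 ∨ σ = -1) (φ : ℝ) : ‖(σ : ℂ) * starRingEnd ℂ (Complex.exp (φ * Complex.I))‖ = 1 := by
  rw [norm_mul, RCLike.norm_conj, Complex.norm_exp_ofReal_mul_I, mul_one, Complex.norm_real, Real.norm_eq_abs]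
  rcases hσ with h | h <;> simp [h]

/-- Gauged vectors have the same norm: `‖μ^j • x‖ = ‖x‖`. [folklore] -/
theorem norm_zpow_gauge_smul {σ : ℝ} (hσ : σ = 1 ∨ σ = -1) (φ : ℝ) (j : ℤ) (x : EuclideanSpace ℂ (Fin 3)) :
    ‖((σ : ℂ) * starRingEnd ℂ (Complex.exp (φ * Complex.I))) ^ j • x‖ = ‖x‖ := by
  rw [norm_smul, norm_zpow, norm_gauge hσ, one_zpow, one_mul]

/-- Gauged vectors have the same symbol form. [folklore] -/
theorem re_inner_symbT_zpow_gauge_smul {σ : ℝ} (hσ : σ = 1 ∨ σ = -1) (φ : ℝ) (j : ℤ) (𝔸 : Torus.Visc4 (Fin 3)) (k : Fin 3 → ℤ)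
    (x : EuclideanSpace ℂ (Fin 3)) :
    (⟪((σ : ℂ) * starRingEnd ℂ (Complex.exp (φ * Complex.I))) ^ j • x,
        Torus.symbT 𝔸 k (((σ : ℂ) * starRingEnd ℂ (Complex.exp (φ * Complex.I))) ^ j • x)⟫_ℂ).re =
      (⟪x, Torus.symbT 𝔸 k x⟫_ℂ).re := by
  rw [re_inner_symbT_smul, norm_zpow, norm_gauge hσ, one_zpow, one_pow, one_mul]

/-- **The hypocoercivity damping pairs like the symbol form**: for transversal `w`,
`Re⟪modalAdjGen (majorTranspose 𝔹) K w, w⟫ = 4π² Re⟪w, T_𝔹(K) w⟫`. [cite: Frisch1995Turbulence, §9.6.3 eq. (9.57) p. 233] -/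
theorem re_inner_modalAdjGen_majorTranspose (𝔹 : Torus.Visc4 (Fin 3)) (K : Fin 3 → ℤ) {w : EuclideanSpace ℂ (Fin 3)}
    (hw : kdot K w = 0) :
    (⟪Torus.modalAdjGen (Torus.majorTranspose 𝔹) K w, w⟫_ℂ).re = 4 * Real.pi ^ 2 * (⟪w, Torus.symbT 𝔹 K w⟫_ℂ).re := by
  rw [Torus.modalAdjGen_apply, inner_smul_left, inner_transversalProj_left_of_kdot_eq_zero K hw, Torus.inner_symbT_majorTranspose_left,
    Complex.conj_ofReal, Complex.re_ofReal_mul]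

/-! ## §2 The fixed-time block split -/

/-- **Block split of the dissipation density (fixed time).**  For a square-summable family `X` with energy `E`, a symbol form whose finite
blocks are `≤ q` and which is coercive with constant `lo` mode by mode, and a finite block `W` off which every mode carried by `X` has
`dmin ≤ 8π²·lo·|k|²`: `4π² Σ_{k∈W} Re⟪X k, T X k⟫ + (dmin/2)(E − Σ_{k∈W} ‖X k‖²) ≤ q`. [cite: BedrossianCotiZelati2017, §2 (hypocoercivity functional with a cross term)] -/
theorem block_split_le {X : (Fin 3 → ℤ) → EuclideanSpace ℂ (Fin 3)} {𝔸 : Torus.Visc4 (Fin 3)} {lo E q dmin : ℝ}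
    (hdmin : 0 ≤ dmin) (hpars : HasSum (fun k => ‖X k‖ ^ 2) E)
    (hblock : ∀ S : Finset (Fin 3 → ℤ), 4 * Real.pi ^ 2 * ∑ k ∈ S, (⟪X k, Torus.symbT 𝔸 k (X k)⟫_ℂ).re ≤ q)
    (hcoer : ∀ k, lo * (freqNormSq k * ‖X k‖ ^ 2) ≤ (⟪X k, Torus.symbT 𝔸 k (X k)⟫_ℂ).re)
    (W : Finset (Fin 3 → ℤ)) (hgap : ∀ k, k ∉ W → X k ≠ 0 → dmin ≤ 8 * Real.pi ^ 2 * lo * freqNormSq k) :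
    4 * Real.pi ^ 2 * ∑ k ∈ W, (⟪X k, Torus.symbT 𝔸 k (X k)⟫_ℂ).re + dmin / 2 * (E - ∑ k ∈ W, ‖X k‖ ^ 2) ≤ q := by
  classical
  -- the energy off the block
  have hrest : HasSum (fun x : {x // x ∉ W} => ‖X x‖ ^ 2) (E - ∑ k ∈ W, ‖X k‖ ^ 2) :=
    (Finset.hasSum_compl_iff (f := fun k => ‖X k‖ ^ 2) W).2 (by rw [sub_add_cancel]; exact hpars)
  -- per-mode: `dmin/2 · ‖X k‖² ≤ 4π² Re_k` off the block
  have hmode : ∀ k, k ∉ W → dmin / 2 * ‖X k‖ ^ 2 ≤ 4 * Real.pi ^ 2 * (⟪X k, Torus.symbT 𝔸 k (X k)⟫_ℂ).re := by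
    intro k hk
    by_cases hX : X k = 0
    · have h0 : lo * (freqNormSq k * ‖X k‖ ^ 2) = 0 := by rw [hX, norm_zero]; ring
      have := hcoer k
      rw [h0] at this
      have hn : ‖X k‖ = 0 := by rw [hX, norm_zero]
      have h4 : 0 ≤ 4 * Real.pi ^ 2 * (⟪X k, Torus.symbT 𝔸 k (X k)⟫_ℂ).re := mul_nonneg (by positivity) this
      rw [hn]
      simpa using h4
    · have h1 := hgap k hk hX
      have h2 := hcoer k
      have h3 : dmin / 2 * ‖X k‖ ^ 2 ≤ 4 * Real.pi ^ 2 * (lo * (freqNormSq k * ‖X k‖ ^ 2)) := by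
        nlinarith [sq_nonneg ‖X k‖]
      exact h3.trans (mul_le_mul_of_nonneg_left h2 (by positivity))
  -- partial sums off the block are bounded
  have hub : ∀ s : Finset {x // x ∉ W}, dmin / 2 * ∑ x ∈ s, ‖X x‖ ^ 2 ≤
      q - 4 * Real.pi ^ 2 * ∑ k ∈ W, (⟪X k, Torus.symbT 𝔸 k (X k)⟫_ℂ).re := by
    intro s
    set S' : Finset (Fin 3 → ℤ) := s.map (Function.Embedding.subtype _) with hS'
    have hdisj : Disjoint W S' := by
      rw [Finset.disjoint_right]
      intro k hk
      rw [hS', Finset.mem_map] at hk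
      obtain ⟨x, _, rfl⟩ := hk
      exact x.2
    have h1 := hblock (W ∪ S')
    rw [Finset.sum_union hdisj, mul_add] at h1
    have h2 : dmin / 2 * ∑ x ∈ s, ‖X x‖ ^ 2 ≤ 4 * Real.pi ^ 2 * ∑ k ∈ S', (⟪X k, Torus.symbT 𝔸 k (X k)⟫_ℂ).re := by
      have e : ∑ x ∈ s, ‖X x‖ ^ 2 = ∑ k ∈ S', ‖X k‖ ^ 2 := by
        rw [hS', Finset.sum_map]
        rfl
      rw [e, Finset.mul_sum, Finset.mul_sum]
      refine Finset.sum_le_sum fun k hk => hmode k ?_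
      exact Finset.disjoint_right.1 hdisj hk
    linarith
  -- pass to the supremum
  by_cases hd : dmin = 0
  · rw [hd, zero_div, zero_mul, add_zero]
    exact hblock W
  · have hdpos : 0 < dmin / 2 := by
      have : 0 < dmin := lt_of_le_of_ne hdmin (Ne.symm hd)
      linarith
    have hlub := isLUB_hasSum (fun x : {x // x ∉ W} => sq_nonneg ‖X x‖) hrest
    have hle : E - ∑ k ∈ W, ‖X k‖ ^ 2 ≤
        (q - 4 * Real.pi ^ 2 * ∑ k ∈ W, (⟪X k, Torus.symbT 𝔸 k (X k)⟫_ℂ).re) / (dmin / 2) := by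
      refine hlub.2 ?_
      rintro _ ⟨s, rfl⟩
      rw [le_div_iff₀ hdpos, mul_comm]
      exact hub s
    have := (le_div_iff₀ hdpos).1 hle
    linarith


/-! ## §3 The conjugate-pair dissipation split for a weak solution -/

/-- Mirror modes of a real field have the same size: `‖û(−k)‖ = ‖û(k)‖`. [folklore] -/
theorem norm_mFourierCoeff_neg {v : UnitAddTorus (Fin 3) → EuclideanSpace ℝ (Fin 3)} (hv : Integrable v volume) (k : Fin 3 → ℤ) :
    ‖mFourierCoeff (EuclideanSpace.complexify ∘ v) (-k)‖ = ‖mFourierCoeff (EuclideanSpace.complexify ∘ v) k‖ := by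
  have h : ∀ i, (mFourierCoeff (EuclideanSpace.complexify ∘ v) (-k)) i = starRingEnd ℂ ((mFourierCoeff (EuclideanSpace.complexify ∘ v) k) i) :=
    fun i => FunctionSpaces.Torus.mFourierCoeff_complexify_neg_apply hv k i
  rw [EuclideanSpace.norm_eq, EuclideanSpace.norm_eq]
  congr 1
  exact Finset.sum_congr rfl fun i _ => by rw [h i, RCLike.norm_conj]

/-- **THE CONJUGATE-PAIR DISSIPATION SPLIT** (hypothesis (H2) of `W7Slot.slot_step`, multiplicity `2`).  Let `u` be a weak solution with tensor `𝔹` in a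
Legendre–Hadamard window (`NearIso 𝔹 lo hi`), `E, Q` as in `exists_energyRep` (only `E t = ∫‖u t‖²` a.e. and the finite-block bounds are used), a slow
chain `Kⱼ = K₀ + j·K_s`, `|j| ≤ 2`, with `K_s ≠ 0` and the `+`/`−` windows disjoint, the gauge `μ = σ·conj e^{iφ}` (`σ = ±1`), and `dmin ≥ 0` with
`dmin ≤ 8π²·lo·|k|²` on every other mode the solution carries.  Then for a.e. `t ∈ (0,T)`, with `w̃ⱼ = μ^j • û(t)(Kⱼ)`:
`2·Σⱼ Re⟪modalAdjGen (majorTranspose 𝔹) Kⱼ w̃ⱼ, w̃ⱼ⟫ + (dmin/2)·(E t − 2·Σⱼ ‖w̃ⱼ‖²) ≤ Q t`. [cite: BedrossianCotiZelati2017, §2 (hypocoercivity functional with a cross term)] -/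
theorem ae_pair_dissipation_split {T : ℝ} {𝔹 : Torus.Visc4 (Fin 3)} {b u : ℝ → UnitAddTorus (Fin 3) → EuclideanSpace ℝ (Fin 3)}
    {F : UnitAddTorus (Fin 3) → EuclideanSpace ℝ (Fin 3)} (h : Torus.IsWeakTensorPassiveVectorOn 0 T 𝔹 b F u) {lo hi : ℝ}
    (h𝔹 : Torus.NearIso 𝔹 lo hi) {E Q : ℝ → ℝ}
    (hE : ∀ᵐ t ∂(volume.restrict (Ioo 0 T)), E t = ∫ x, ‖u t x‖ ^ 2)
    (hQ : ∀ᵐ t ∂(volume.restrict (Ioo 0 T)), ∀ S : Finset (Fin 3 → ℤ),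
      4 * Real.pi ^ 2 * ∑ k ∈ S, (⟪mFourierCoeff (EuclideanSpace.complexify ∘ u t) k, Torus.symbT 𝔹 k (mFourierCoeff (EuclideanSpace.complexify ∘ u t) k)⟫_ℂ).re ≤ Q t)
    (K0 Ks : Fin 3 → ℤ) (hKs : Ks ≠ 0)
    (hdisj : ∀ j ∈ ({-2, -1, 0, 1, 2} : Finset ℤ), ∀ j' ∈ ({-2, -1, 0, 1, 2} : Finset ℤ), K0 + j • Ks ≠ -(K0 + j' • Ks))
    {σ : ℝ} (hσ : σ = 1 ∨ σ = -1) (φ : ℝ) {dmin : ℝ} (hdmin : 0 ≤ dmin)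
    (hgap : ∀ᵐ t ∂(volume.restrict (Ioo 0 T)), ∀ k : Fin 3 → ℤ,
      (∀ j ∈ ({-2, -1, 0, 1, 2} : Finset ℤ), k ≠ K0 + j • Ks ∧ k ≠ -(K0 + j • Ks)) → mFourierCoeff (EuclideanSpace.complexify ∘ u t) k ≠ 0 →
      dmin ≤ 8 * Real.pi ^ 2 * lo * freqNormSq k) :
    ∀ᵐ t ∂(volume.restrict (Ioo 0 T)),
      2 * ∑ j ∈ ({-2, -1, 0, 1, 2} : Finset ℤ),
          (⟪Torus.modalAdjGen (Torus.majorTranspose 𝔹) (K0 + j • Ks) (((σ : ℂ) * starRingEnd ℂ (Complex.exp (φ * Complex.I))) ^ j • mFourierCoeff (EuclideanSpace.complexify ∘ u t) (K0 + j • Ks)),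
            ((σ : ℂ) * starRingEnd ℂ (Complex.exp (φ * Complex.I))) ^ j • mFourierCoeff (EuclideanSpace.complexify ∘ u t) (K0 + j • Ks)⟫_ℂ).re +
        dmin / 2 * (E t - 2 * ∑ j ∈ ({-2, -1, 0, 1, 2} : Finset ℤ), ‖((σ : ℂ) * starRingEnd ℂ (Complex.exp (φ * Complex.I))) ^ j • mFourierCoeff (EuclideanSpace.complexify ∘ u t) (K0 + j • Ks)‖ ^ 2) ≤ Q t := by
  classical
  set S5 : Finset ℤ := ({-2, -1, 0, 1, 2} : Finset ℤ) with hS5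
  have htr := ae_all_iff.2 fun k => h.ae_sum_mul_mFourierCoeff_eq_zero k
  filter_upwards [hE, hQ, hgap, htr, h.ae_memLp_two, h.ae_integrable_slice] with t hEt hQt hgapt htrt h2 hint
  -- notation at time `t`
  set Xt : (Fin 3 → ℤ) → EuclideanSpace ℂ (Fin 3) := fun k => mFourierCoeff (EuclideanSpace.complexify ∘ u t) k with hXt
  have hkdot : ∀ k, kdot k (Xt k) = 0 := fun k => by rw [kdot_apply]; exact htrt k
  -- injectivity of the two parametrisations and disjointness of the windows
  have hinj : Set.InjOn (fun j : ℤ => K0 + j • Ks) ↑S5 := by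
    intro j _ j' _ hjj'
    have h1 : (j - j') • Ks = 0 := by rw [sub_zsmul]; exact sub_eq_zero.2 (add_left_cancel hjj')
    rcases smul_eq_zero.1 h1 with h | h
    · exact sub_eq_zero.1 h
    · exact absurd h hKs
  have hinj' : Set.InjOn (fun j : ℤ => -(K0 + j • Ks)) ↑S5 := fun j hj j' hj' hjj' => hinj hj hj' (neg_injective hjj')
  set W : Finset (Fin 3 → ℤ) := S5.image (fun j : ℤ => K0 + j • Ks) ∪ S5.image (fun j : ℤ => -(K0 + j • Ks)) with hW
  have hWdisj : Disjoint (S5.image (fun j : ℤ => K0 + j • Ks)) (S5.image (fun j : ℤ => -(K0 + j • Ks))) := by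
    rw [Finset.disjoint_left]
    intro k hk hk'
    rw [Finset.mem_image] at hk hk'
    obtain ⟨j, hj, rfl⟩ := hk
    obtain ⟨j', hj', hjj'⟩ := hk'
    exact hdisj j hj j' hj' hjj'.symm
  have hnotW : ∀ k, k ∉ W → ∀ j ∈ S5, k ≠ K0 + j • Ks ∧ k ≠ -(K0 + j • Ks) := by
    intro k hk j hj
    rw [hW, Finset.mem_union, not_or, Finset.mem_image, Finset.mem_image, not_exists, not_exists] at hk
    exact ⟨fun e => hk.1 j ⟨hj, e.symm⟩, fun e => hk.2 j ⟨hj, e.symm⟩⟩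
  -- the fixed-time split on the ten-mode block `W`
  have hpars : HasSum (fun k => ‖Xt k‖ ^ 2) (E t) := by rw [hEt]; exact hasSum_sq_norm_mFourierCoeff_complexify h2
  have hcoer : ∀ k, lo * (freqNormSq k * ‖Xt k‖ ^ 2) ≤ (⟪Xt k, Torus.symbT 𝔹 k (Xt k)⟫_ℂ).re :=
    fun k => Torus.lo_mul_le_re_inner_symbT h𝔹 (htrt k)
  have hsplit := block_split_le hdmin hpars hQt hcoer W (fun k hk hX => hgapt k (hnotW k hk) hX)
  -- fold the block sums: reality + gauge
  have hsumW : ∀ f : (Fin 3 → ℤ) → ℝ, (∀ k, f (-k) = f k) → ∑ k ∈ W, f k = 2 * ∑ j ∈ S5, f (K0 + j • Ks) := by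
    intro f hf
    rw [hW, Finset.sum_union hWdisj, Finset.sum_image hinj, Finset.sum_image hinj', two_mul]
    congr 1
    exact Finset.sum_congr rfl fun j _ => hf _
  have hnorm : ∑ k ∈ W, ‖Xt k‖ ^ 2 = 2 * ∑ j ∈ S5, ‖((σ : ℂ) * starRingEnd ℂ (Complex.exp (φ * Complex.I))) ^ j • Xt (K0 + j • Ks)‖ ^ 2 := by
    rw [hsumW (fun k => ‖Xt k‖ ^ 2) (fun k => by simp only [hXt]; rw [norm_mFourierCoeff_neg hint.1])]
    congr 1
    exact Finset.sum_congr rfl fun j _ => by rw [norm_zpow_gauge_smul hσ]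
  have hdiss : 4 * Real.pi ^ 2 * ∑ k ∈ W, (⟪Xt k, Torus.symbT 𝔹 k (Xt k)⟫_ℂ).re =
      2 * ∑ j ∈ S5, (⟪Torus.modalAdjGen (Torus.majorTranspose 𝔹) (K0 + j • Ks) (((σ : ℂ) * starRingEnd ℂ (Complex.exp (φ * Complex.I))) ^ j • Xt (K0 + j • Ks)),
        ((σ : ℂ) * starRingEnd ℂ (Complex.exp (φ * Complex.I))) ^ j • Xt (K0 + j • Ks)⟫_ℂ).re := by
    rw [hsumW (fun k => (⟪Xt k, Torus.symbT 𝔹 k (Xt k)⟫_ℂ).re) (fun k => by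
      simp only [hXt]
      exact re_inner_symbT_neg_conj 𝔹 k (fun i => FunctionSpaces.Torus.mFourierCoeff_complexify_neg_apply hint.1 k i)),
      ← mul_assoc, mul_comm (4 * Real.pi ^ 2) 2, mul_assoc, Finset.mul_sum]
    congr 1
    refine Finset.sum_congr rfl fun j _ => ?_
    rw [re_inner_modalAdjGen_majorTranspose _ _ (by rw [map_smul, hkdot, smul_zero]), re_inner_symbT_zpow_gauge_smul hσ]
  rw [hnorm, hdiss] at hsplit
  exact hsplit

/-- **The conjugate-pair dissipation split, cell form on the continuous representatives** (`modeRep`, all modes agreeing with their representatives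
a.e. by `ae_forall_eq_modeRep`). [cite: BedrossianCotiZelati2017, §2 (hypocoercivity functional with a cross term)] -/
theorem ae_pair_dissipation_split_rep {k₀ : ℕ} (W₁ : LatticeWord k₀) (n : ℕ) {T : ℝ} (hT : 0 ≤ T) {𝔹 : Torus.Visc4 (Fin 3)}
    {F : UnitAddTorus (Fin 3) → EuclideanSpace ℝ (Fin 3)} {u : ℝ → UnitAddTorus (Fin 3) → EuclideanSpace ℝ (Fin 3)}
    (h : Torus.IsWeakTensorPassiveVectorOn 0 T 𝔹 (W₁.cell n) F u) (hF : Integrable F volume) {lo hi : ℝ}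
    (h𝔹 : Torus.NearIso 𝔹 lo hi) {E Q : ℝ → ℝ}
    (hE : ∀ᵐ t ∂(volume.restrict (Ioo 0 T)), E t = ∫ x, ‖u t x‖ ^ 2)
    (hQ : ∀ᵐ t ∂(volume.restrict (Ioo 0 T)), ∀ S : Finset (Fin 3 → ℤ),
      4 * Real.pi ^ 2 * ∑ k ∈ S, (⟪mFourierCoeff (EuclideanSpace.complexify ∘ u t) k, Torus.symbT 𝔹 k (mFourierCoeff (EuclideanSpace.complexify ∘ u t) k)⟫_ℂ).re ≤ Q t)
    (K0 Ks : Fin 3 → ℤ) (hKs : Ks ≠ 0)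
    (hdisj : ∀ j ∈ ({-2, -1, 0, 1, 2} : Finset ℤ), ∀ j' ∈ ({-2, -1, 0, 1, 2} : Finset ℤ), K0 + j • Ks ≠ -(K0 + j' • Ks))
    {σ : ℝ} (hσ : σ = 1 ∨ σ = -1) (φ : ℝ) {dmin : ℝ} (hdmin : 0 ≤ dmin)
    (hgap : ∀ᵐ t ∂(volume.restrict (Ioo 0 T)), ∀ k : Fin 3 → ℤ,
      (∀ j ∈ ({-2, -1, 0, 1, 2} : Finset ℤ), k ≠ K0 + j • Ks ∧ k ≠ -(K0 + j • Ks)) → mFourierCoeff (EuclideanSpace.complexify ∘ u t) k ≠ 0 →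
      dmin ≤ 8 * Real.pi ^ 2 * lo * freqNormSq k) :
    ∀ᵐ t ∂(volume.restrict (Ioo 0 T)),
      2 * ∑ j ∈ ({-2, -1, 0, 1, 2} : Finset ℤ),
          (⟪Torus.modalAdjGen (Torus.majorTranspose 𝔹) (K0 + j • Ks) (((σ : ℂ) * starRingEnd ℂ (Complex.exp (φ * Complex.I))) ^ j • modeRep W₁ n 𝔹 F u (K0 + j • Ks) t),
            ((σ : ℂ) * starRingEnd ℂ (Complex.exp (φ * Complex.I))) ^ j • modeRep W₁ n 𝔹 F u (K0 + j • Ks) t⟫_ℂ).re +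
        dmin / 2 * (E t - 2 * ∑ j ∈ ({-2, -1, 0, 1, 2} : Finset ℤ), ‖((σ : ℂ) * starRingEnd ℂ (Complex.exp (φ * Complex.I))) ^ j • modeRep W₁ n 𝔹 F u (K0 + j • Ks) t‖ ^ 2) ≤ Q t := by
  filter_upwards [ae_pair_dissipation_split h h𝔹 hE hQ K0 Ks hKs hdisj hσ φ hdmin hgap, ae_forall_eq_modeRep W₁ n hT h hF]
    with t ht hrep
  simp only [← hrep]
  exact ht

end Summit.AnomalousDissipation.AnomalousDissipation.Theorems.SolenoidalFractalHomogenisation.LagrangianStep.CellChain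

end
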